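import Summits.AtomisticToContinuum.BoseEinsteinCondensation.Theses.BECModePrice
import Summits.AtomisticToContinuum.BoseEinsteinCondensation.Theorems.BECLaplacianL1DiluteEnergyBound

/-!
# Route `BECModePrice`, support item `DiluteEnergyBound` (stmt-AtomisticToContinuum-18298)

The crude dilute energy bound along the thermodynamic box sequence `L_N = (N/ρ)^{1/3}`:
for every repulsive finite-range pair potential `v` (hard cores allowed) there are `C, ρ₀ > 0`
with `E₀^per(N, L_N) ≤ C ρ^{2/3} N` for `0 < ρ < ρ₀` and all large `N`.

This route decl is word-for-word the support item `DiluteEnergyBound` of route `BECLaplacianL1`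
(stmt-AtomisticToContinuum-9011), settled by
`Summit.AtomisticToContinuum.BoseEinsteinCondensation.Theorems.diluteEnergyBound_proof`
(Ruelle subadditivity with one-particle cells at Dirichlet density `2ρ`, one-particle scaling,
periodic ≤ Dirichlet at the double density [Ruelle1969, §3.5.11; LSSY2005, Ch. 2]); the two
propositions are definitionally equal, so the proof transfers verbatim.
-/

namespace Summit.AtomisticToContinuum.BoseEinsteinCondensation.Theorems

/-- **`BECModePrice.DiluteEnergyBound` holds** (settles stmt-AtomisticToContinuum-18298, exact route
decl): for every repulsive finite-range `v` there are `C > 0` and `ρ₀ > 0` such that for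
`0 < ρ < ρ₀`, eventually in `N`,
`periodicGroundStateEnergy v N (sideLength ρ N) ≤ ofReal (C ρ^{2/3} N)`.
Transferred from the identical (definitionally equal) `BECLaplacianL1.DiluteEnergyBound`,
proved as `diluteEnergyBound_proof`. [cite: Ruelle1969, §3.5.11] -/
theorem becModePrice_diluteEnergyBound_proof :
    Summit.AtomisticToContinuum.BoseEinsteinCondensation.Theses.BECModePrice.DiluteEnergyBound := by
  unfold Summit.AtomisticToContinuum.BoseEinsteinCondensation.Theses.BECModePrice.DiluteEnergyBound
  exact diluteEnergyBound_proof

end Summit.AtomisticToContinuum.BoseEinsteinCondensation.Theorems
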